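import Summits.HodgeConjecture.HodgeConjecture.Theorems.F0P3SpectralPacketXiHSigned           -- ★ (N) FILE 3r (this seat): `XiHPacketsSigned`, `rhoXiS`, `trHSψ_rhoXiS_eq` (+ ★ 3h `trHSψ`, ★ 3f `transportAPackets`)
import Summits.HodgeConjecture.HodgeConjecture.Theorems.F0P3bLocalExpansionAtKitOfRecord     -- ★ (F0P3b desk): `HTraceProductForm` (+ ★ K0 `F0P3KitOfRecord`: `GHSide`, `XiSide`, `cptXi₀`; ★ `archPacketOfRecord`, `nCompactOfRecord`)
import Summits.HodgeConjecture.HodgeConjecture.Theorems.F0P3GHSideOfFibres                   -- ★ p01 (g8∕g9): `ghOfFibres` (+ `ghOfFibres_matchesS_iff`, `ghOfFibres_TestSH`)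
import HarnessLib

/-!
# (N) DEFS, FILE 3r′ — (P3′)-H OF LETTER K9-STF BY NAME: `HTraceProductForm` AT `ghOfFibres … (trHS := trHSψ)` FROM THE SIGNED `H`-SIDE ξ-SHAPE, UNDER ONE EXPLICIT SIGN-BOOKKEEPING
# HYPOTHESIS (Rogawski §13.1 Prop. 13.1.4 p. 199; §12.3 Prop. 12.3.3 (a) p. 178; §14.4 Prop. 14.4.2 (c) p. 236; §14.6 p. 243 l. 9 – p. 244 l. 17)

Cell `hodgecm-mathlib` (D-0151), F0∕P3 «U3-mult», crux H413 (`stmt-HodgeConjecture-24833`), route of record `HCCMUnconditional`.  (N) lead pen F0P3a-p01 (g13); twin of ★ FILE 3q′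
p843829 on the `H`-side; LEAD F0P3a-plan (g10) T9-22 (2); desk F0P3-plan (g9) («K9STF ⟸ TUPLE»); F0P3b-plan (g13) (owner of ★ `HTraceProductForm`, RULING «K» currency).  PROOF LANE: one
theorem, 0 definitions, no instance, no notation, no named fact, no `sorry`; `--supports stmt-HodgeConjecture-24833 --as helper`.
HONEST LABEL: HC_CM is proved only modulo the printed citations until rung 0 closes; this file proves no printed statement — it discharges the clause (P3′)-H of letter K9-STF
(`K9SpectralLetterSigned`, `Cruxes/H413/Lines/F0_U3LettersRung1Defs.lean` :1484–:1489) AT THE (N) TUPLE, BY NAME, from the signed `H`-side shape ★ FILE 3r `XiHPacketsSigned` (junction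
input `hXiHS`), the member-admissibility kit law, two junction identifications, and ONE EXPLICIT SIGN-BOOKKEEPING HYPOTHESIS `hsign` — «for `S ⊇ ram ξ`,
`κH(ξ) · ∏_{v ∈ S} ε(ξ, v) = [cptXi₀ ι μω ξ] · (−1)^{nCompactOfRecord L} · c`» — whose discharge (from `ε(ξ, v) = ε_v(H) = 1` off `ram ξ`, the compact-place scalar and `c = ∏ c_v`,
RULINGS K1∕K2∕K4) is the junction desk's, stated here and not smuggled.

WHAT IS PROVED.  With `gh := ghOfFibres ι T hT 𝔰 hg hsm trGS trHS` at `𝔰 := ⟨traceGp, Smooth, PG, SpectralPacketH 𝔩 𝔞 𝔞H DiscH, nG, nH, trG, trH, Matches⟩` and the (N) slot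
`trHS S ρ f′_S := ρ.trHSψ ψ S (ψ_* νG) archTr f′_S` (★ FILE 3h; BOARD §B2), the clause `HTraceProductForm ι T hT gh ξd μω c jInf dsInf archTr νG` («`Tr ξ_S(f^H_S) = [cptXi₀ ξ] · (−1)^N · c ·
(A πⁿ_ι + A πˢ_ι) · ∏_{v ∈ S} (Tr πⁿ_v + Tr πˢ_v)(f′_v)` under `MatchesS`», ★ `F0P3bLocalExpansionAtKitOfRecord`) HOLDS as soon as `ξd.ρXi = rhoXiS hXiHS`, `ξd.packFin = Pk′`,
`PkInf := archPacketOfRecord ι μω jInf dsInf`, and `hsign`.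

References: [Rogawski1990] §13.1 Prop. 13.1.3 (d), Prop. 13.1.4 p. 199; §12.3 Prop. 12.3.3 (a) p. 178; §14.4 Prop. 14.4.2 (c) p. 236; §14.6 p. 243 l. 9 – p. 244 l. 17; §14.2 pp. 232–233.
-/

set_option autoImplicit false
-- the mandated namespace repeats `HodgeConjecture.HodgeConjecture`, as in every `Theorems/*.lean` of this sub-problem
set_option linter.dupNamespace false

noncomputable section

open NumberField IsDedekindDomain MeasureTheory
open scoped Matrix MatrixGroups

open Literature.NumberTheory Literature.NumberTheory.Automorphic Literature.NumberTheory.Automorphic.UnitaryGroup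
open Literature.NumberTheory.Rogawski1990 Literature.NumberTheory.GaloisRepresentations
open Literature.RepresentationTheory.BorelWallach2000 Literature.RepresentationTheory.KonnoKonno2007
open Summit.HodgeConjecture.HodgeConjecture.Cruxes.H413.F0P3InnerFormClassificationV6 (Gp Places Sockets TestGp TestG TestH splitForm)
open Summit.HodgeConjecture.HodgeConjecture.Cruxes.H413.F0P3InnerFormClassificationV6.ClassificationKit (memberCoeff)
open Summit.HodgeConjecture.HodgeConjecture.Cruxes.H413.F0P3LocalPacketKit
open Summit.HodgeConjecture.HodgeConjecture.Cruxes.H413.F0P3ArchPacketKit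
open Summit.HodgeConjecture.HodgeConjecture.Cruxes.H413.F0P3SemilocalTestFunctionsOfRecord (TestS₀ tens₀)
open Summit.HodgeConjecture.HodgeConjecture.Cruxes.H413.F0P3TestFunctionsOfRecord (Unr₀)
open Summit.HodgeConjecture.HodgeConjecture.Cruxes.H413.F0P3KitOfRecord (GHSide XiSide cptXi₀)
open Summit.HodgeConjecture.HodgeConjecture.Cruxes.H413.F0P3XiArchDataOfRecord (nCompactOfRecord)
open Summit.HodgeConjecture.HodgeConjecture.Cruxes.H413.F0P3XiArchPacketOfRecord (archPacketOfRecord)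
open Summit.HodgeConjecture.HodgeConjecture.Cruxes.H413.F0P3GHSideOfFibres (ghOfFibres)
open Summit.HodgeConjecture.HodgeConjecture.Cruxes.H413.F0P3bLocalExpansionAtKitOfRecord (HTraceProductForm)

namespace Summit.HodgeConjecture.HodgeConjecture.Cruxes.H413.F0P3SpectralPacket.SpectralPacketH

open Summit.HodgeConjecture.HodgeConjecture.Cruxes.H413.F0P3GlobalPacket

variable {L : Type} [Field L] [NumberField L] [IsCMField L] {H : Matrix (Fin 3) (Fin 3) L} {ι : L →+* ℂ} {T : GL (Fin 3) ℂ}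
  {hT : (T : Matrix (Fin 3) (Fin 3) ℂ)ᴴ * H.map ι * (T : Matrix (Fin 3) (Fin 3) ℂ) = Literature.Geometry.ComplexHyperbolic.BallModel.J}
  {𝔩 : ∀ v : HeightOneSpectrum (𝓞 ↥(maximalRealSubfield L)), LocalPacketKit L (splitForm L 3) v} {𝔞 : ArchPacketKit} {𝔞H : ArchPacketKitH 𝔞}
  {DiscH : GlobalPacketH 𝔩 → 𝔞H.PktInfH → Prop}
  [∀ v : HeightOneSpectrum (𝓞 ↥(maximalRealSubfield L)), MeasurableSpace ((cmDatum L 3 (splitForm L 3)).Local v)]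
  [∀ v : HeightOneSpectrum (𝓞 ↥(maximalRealSubfield L)), BorelSpace ((cmDatum L 3 (splitForm L 3)).Local v)]
  -- the `G′`-side sockets other than `PacketH` (the letter's `𝔰 := ⟨𝔨.traceGp, 𝔨.Smooth, PG, PH, nG, nH, trG, trH, 𝔨.Matches⟩`)
  {μGp : Measure (Gp L H).automorphicQuotient} [(Gp L H).IsAutomorphicMeasure μGp]
  {traceGp : TestGp L H →ₗ[ℂ] ℂ} {Smooth : TestGp L H → Prop} {PG : Type} {nG : PG → ℂ} {nH : SpectralPacketH 𝔩 𝔞 𝔞H DiscH → ℂ}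
  {trG : PG → TestG L → ℂ} {trH : SpectralPacketH 𝔩 𝔞 𝔞H DiscH → TestH L → ℂ} {Matches : TestGp L H → TestG L → TestH L → Prop}
  {Pk' : OneDimAutRepH L → ∀ v : HeightOneSpectrum (𝓞 ↥(maximalRealSubfield L)), CMLocalAPacket L H v}
  {χ : OneDimAutRepH L → ∀ v : HeightOneSpectrum (𝓞 ↥(maximalRealSubfield L)),
    (UnitaryGroup.cmDatum L 2 (Matrix.of fun i j : Fin 2 => if i.val + j.val + 1 = 2 then (1 : L) else 0)).Local v ×
      (UnitaryGroup.cmDatum L 1 (Matrix.of fun i j : Fin 1 => if i.val + j.val + 1 = 1 then (1 : L) else 0)).Local v →* ℂˣ}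
  {hχ : ∀ (ξ : OneDimAutRepH L) (v : HeightOneSpectrum (𝓞 ↥(maximalRealSubfield L))),
    IsOpen (((χ ξ v).ker : Subgroup ((UnitaryGroup.cmDatum L 2 (Matrix.of fun i j : Fin 2 => if i.val + j.val + 1 = 2 then (1 : L) else 0)).Local v ×
      (UnitaryGroup.cmDatum L 1 (Matrix.of fun i j : Fin 1 => if i.val + j.val + 1 = 1 then (1 : L) else 0)).Local v)) :
      Set ((UnitaryGroup.cmDatum L 2 (Matrix.of fun i j : Fin 2 => if i.val + j.val + 1 = 2 then (1 : L) else 0)).Local v ×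
        (UnitaryGroup.cmDatum L 1 (Matrix.of fun i j : Fin 1 => if i.val + j.val + 1 = 1 then (1 : L) else 0)).Local v))}
  {ε : OneDimAutRepH L → HeightOneSpectrum (𝓞 ↥(maximalRealSubfield L)) → ℤ} {κH : OneDimAutRepH L → ℤ}

open scoped Classical in
/-- **(r5) (P3′)-H OF LETTER K9-STF AT THE TUPLE, BY NAME.**  For the letter's `gh := ghOfFibres ι T hT 𝔰 hg hsm trGS trHS` with the (N) slot `trHS S ρ f′_S := ρ.trHSψ ψ S (ψ_* νG) archTr f′_S`,
a ξ-side `ξd` reading `ρXi := rhoXiS hXiHS` and `packFin := Pk′`, archimedean A-packets `archPacketOfRecord ι μω jInf dsInf`, and the SIGN-BOOKKEEPING hypothesis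
`hsign : ram ξ ⊆ S → κH(ξ) · ∏_{v ∈ S} ε(ξ, v) = [cptXi₀ ι μω ξ] · (−1)^N · c` (junction's, RULINGS K1∕K2∕K4): `HTraceProductForm ι T hT gh ξd μω c jInf dsInf archTr νG` —
«`Tr ξ_S(f^H_S) = [cptXi₀ ξ] · (−1)^N · c · (A πⁿ_ι + A πˢ_ι) · ∏_{v ∈ S} (Tr πⁿ_v + Tr πˢ_v)(f′_v)`» [Prop. 13.1.4; 12.3.3 (a); Prop. 14.4.2 (c); p. 243 l. 9 – p. 244 l. 17] — modulo ONE kit law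
(member admissibility of `ξ_H(ξ_v)`, `hadm`).  Proof: `MatchesS ↔ … ∧ fSH = fS` (★ `ghOfFibres`), then ★ FILE 3r `trHSψ_rhoXiS_eq` and `hsign`.
[cite: Rogawski1990, §13.1 Prop. 13.1.3 (d), Prop. 13.1.4 p. 199; §12.3 Prop. 12.3.3 (a) p. 178; §14.4 Prop. 14.4.2 (c) p. 236; §14.6 p. 243 l. 9 – p. 244 l. 17] -/
theorem hTraceProductForm_ghOfFibres_of_xiHPacketsSigned
    (ψ : ∀ v : HeightOneSpectrum (𝓞 ↥(maximalRealSubfield L)), (cmDatum L 3 H).Local v ≃ₜ* (cmDatum L 3 (splitForm L 3)).Local v)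
    (νG : ∀ v : HeightOneSpectrum (𝓞 ↥(maximalRealSubfield L)), @Measure ((cmDatum L 3 H).Local v) (borel _))
    (hνl : ∀ v : HeightOneSpectrum (𝓞 ↥(maximalRealSubfield L)), letI : MeasurableSpace ((cmDatum L 3 H).Local v) := borel _; (νG v).IsMulLeftInvariant)
    (hνc : ∀ v : HeightOneSpectrum (𝓞 ↥(maximalRealSubfield L)), letI : MeasurableSpace ((cmDatum L 3 H).Local v) := borel _; IsFiniteMeasureOnCompacts (νG v))
    (μω : HeckeCharacter L) (c : ℚ) (jInf dsInf : ℤ → ℤ → ℤ → GKIrrClass (uFormGroup (Fin 2) (Fin 1)))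
    (archTr : GKIrrClass (uFormGroup (Fin 2) (Fin 1)) → (UnitaryGroup.arch (↥(maximalRealSubfield L)) L (IsCMField.complexConj L) 3 H → ℂ) → ℂ)
    (hXiHS : XiHPacketsSigned 𝔩 𝔞 𝔞H DiscH (transportAPackets ψ Pk') (archPacketOfRecord ι μω jInf dsInf) χ hχ ε κH)
    (hadm : ∀ (ξ : OneDimAutRepH L) (v : HeightOneSpectrum (𝓞 ↥(maximalRealSubfield L))), ∀ π ∈ (𝔩 v).mem ((𝔩 v).xiH ((rhoXiS hXiHS ξ).fin.loc v)), π.IsAdmissible)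
    (hg : ∀ f' : TestGp L H, Smooth f' → ∃ (f : TestG L) (fH : TestH L), Matches f' f fH)
    (hsm : ∀ (S : Finset (Places L)) (fS : TestS₀ L H ι T hT S) (fT : Unr₀ L H S), Smooth (tens₀ S fS fT))
    (trGS : ∀ S : Finset (Places L), PG → TestS₀ L H ι T hT S → ℂ)
    (ξd : XiSide L H PG (SpectralPacketH 𝔩 𝔞 𝔞H DiscH)) (hPi : ∀ ξ : OneDimAutRepH L, ξd.ρXi ξ = rhoXiS hXiHS ξ)
    (hPk : ∀ (ξ : OneDimAutRepH L) (v : HeightOneSpectrum (𝓞 ↥(maximalRealSubfield L))), ξd.packFin ξ v = Pk' ξ v)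
    (hsign : ∀ (ξ : OneDimAutRepH L) (S : Finset (Places L)), ξd.ram ξ ⊆ S →
      (κH ξ : ℂ) * ∏ v : ↥S, (ε ξ v.1 : ℂ) = (if cptXi₀ ι μω ξ then 1 else 0) * (-1) ^ nCompactOfRecord L * (c : ℂ)) :
    HTraceProductForm ι T hT
      (ghOfFibres ι T hT (⟨traceGp, Smooth, PG, SpectralPacketH 𝔩 𝔞 𝔞H DiscH, nG, nH, trG, trH, Matches⟩ : Sockets L H μGp) hg hsm trGS
        (fun S ρ fS => ρ.trHSψ ψ S (fun v => @Measure.map _ _ (borel _) _ (ψ v) (νG v)) archTr fS))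
      ξd μω c jInf dsInf archTr νG := by
  letI : ∀ v : HeightOneSpectrum (𝓞 ↥(maximalRealSubfield L)), MeasurableSpace ((cmDatum L 3 H).Local v) := fun _ => borel _
  haveI : ∀ v : HeightOneSpectrum (𝓞 ↥(maximalRealSubfield L)), BorelSpace ((cmDatum L 3 H).Local v) := fun _ => ⟨rfl⟩
  haveI : ∀ v : HeightOneSpectrum (𝓞 ↥(maximalRealSubfield L)), (νG v).IsMulLeftInvariant := hνl
  haveI : ∀ v : HeightOneSpectrum (𝓞 ↥(maximalRealSubfield L)), IsFiniteMeasureOnCompacts (νG v) := hνc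
  intro ξ S hS fS fSG fSH hm
  obtain ⟨-, hfS⟩ := hm
  rw [hfS]
  change (ξd.ρXi ξ).trHSψ ψ S (fun v => @Measure.map _ _ (borel _) _ (ψ v) (νG v)) archTr fS = _
  rw [hPi ξ, trHSψ_rhoXiS_eq ψ hXiHS ξ (hadm ξ) S fS archTr, hsign ξ S hS]
  simp only [hPk ξ, mul_assoc]

end Summit.HodgeConjecture.HodgeConjecture.Cruxes.H413.F0P3SpectralPacket.SpectralPacketH

end
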